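import Summits.ValiantsHypothesis.ValiantsHypothesis.Theorems.LacunarySymmetroidMatrixDescartesChainLadder
import Summits.ValiantsHypothesis.ValiantsHypothesis.Theorems.LacunarySymmetroidMatrixDescartesCensusM3K5T27

/-!
# `MatrixDescartes` census — the CHAIN-LADDER RAYS of the certified row `M3K5T27`: `ζ_sym(3, 4(j+1)+1+i) ≥ 27(j+1) + 3·i`

HONEST FRAMING.  Object-search cell `pub-symmetroid`, crux `Theses.LacunarySymmetroid.MatrixDescartes`
(stmt-ValiantsHypothesis-18050); seat val-sym-mdr-p1 (g8).  LOWER-bound rows in census (CONJECTURE-A) currency; nothing about the crux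
`MatrixDescartes` (upper bound at fat formats), `DoorA26` / `DoorA34`, or `VP ≠ VNP`.  No definitions.

The typer's kernel certificate `Census.M3K5T27` (`ζ_sym(3,5) ≥ 27`: closed form `Census.M3K5T27.eval_det` + sign alternation at 28 rational
points) is fed — with the SAME certificate data and tactic blocks, re-checked here once — to the CHAIN LADDER in certificate form
(`Chain.not_posRootLawAt_ladder_add_of_certificate`: chaining the certificate with its own `x ↦ 1/x` reversal `j` times multiplies the
alternation count by `j+1` at the price of `4` letters per copy, and each of `i` grafted letters buys `m = 3` more), giving the
two-parameter family `ray (j i) : ¬ PosRootLawAt 3 ((j+1)·4 + 1 + i) ((j+1)·27 + i·3 − 1)` and numeral instances.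
[folklore] (intermediate value theorem; certificate arithmetic by `norm_num`, heartbeat budget as in the source certificate file).
-/

-- `Summit.ValiantsHypothesis.ValiantsHypothesis.…` repeats a component by the D-0017 layout
-- (single-conjunct summit), which the `dupNamespace` linter flags; the name is mandated.
set_option linter.dupNamespace false

namespace Summit.ValiantsHypothesis.ValiantsHypothesis.Theorems.LacunarySymmetroidMatrixDescartes.Census.Chain.RayM3K5T27

open Summit.ValiantsHypothesis.ValiantsHypothesis.Theorems.MatrixDescartes.Negative (PosRootLawAt)
open scoped BigOperators Matrix

-- 28 + 27 exact evaluations of the certificate's closed form exceed the default heartbeat budget (as in `Census.M3K5T27`).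
set_option maxHeartbeats 40000000 in
set_option exponentiation.threshold 4288 in
/-- **The chain-ladder rays of `M3K5T27`**: for every `j, i`, `ζ_sym(3, 4(j+1)+1+i) ≥ 27(j+1) + 3i` —
`¬ PosRootLawAt 3 ((j+1)·4 + 1 + i) ((j+1)·27 + i·3 − 1)` (the certified `27`-alternation row laddered `j` times and grafted `i` times).
[folklore] -/
theorem ray (j i : ℕ) : ¬ PosRootLawAt 3 ((j + 1) * 4 + 1 + i) ((j + 1) * 27 + i * 3 - 1) :=
  Summit.ValiantsHypothesis.ValiantsHypothesis.Theorems.LacunarySymmetroidMatrixDescartes.Census.Chain.not_posRootLawAt_ladder_add_of_certificate (N := 27)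
    Summit.ValiantsHypothesis.ValiantsHypothesis.Theorems.LacunarySymmetroidMatrixDescartes.Census.M3K5T27.eval_det
    (by intro l; fin_cases l <;> (unfold Matrix.IsSymm; ext i j; fin_cases i <;> fin_cases j <;> rfl))
    (![1/128, 1/32, 1/16, 13/128, 7/64, 1/8, 3/16, 29/128, 15/64, 1/4, 9/32, 5/16, 3/8, 7/16, 15/32, 1/2, 5/8, 11/16, 23/32, 93/128, 47/64, 3/4, 1, 67/64, 17/16, 35/32, 2, 16] : Fin 28 → ℝ)
    (by
      refine Fin.strictMono_iff_lt_succ.2 fun j => ?_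
      fin_cases j <;> simp only [Fin.castSucc_mk, Fin.succ_mk] <;> norm_num)
    (by intro j; fin_cases j <;> norm_num)
    (by intro j; fin_cases j <;> simp only [Fin.castSucc_mk, Fin.succ_mk] <;> norm_num)
    (by norm_num) j i

/-- `ζ_sym(3,9) ≥ 54` (certificate `M3K5T27` laddered `1` time(s), grafted `0` time(s)). [folklore] -/
theorem row_3_9 : ¬ PosRootLawAt 3 9 53 := by
  have h := ray 1 0
  norm_num at h
  exact h

/-- `ζ_sym(3,10) ≥ 57` (certificate `M3K5T27` laddered `1` time(s), grafted `1` time(s)). [folklore] -/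
theorem row_3_10 : ¬ PosRootLawAt 3 10 56 := by
  have h := ray 1 1
  norm_num at h
  exact h

/-- `ζ_sym(3,13) ≥ 81` (certificate `M3K5T27` laddered `2` time(s), grafted `0` time(s)). [folklore] -/
theorem row_3_13 : ¬ PosRootLawAt 3 13 80 := by
  have h := ray 2 0
  norm_num at h
  exact h

/-- `ζ_sym(3,14) ≥ 84` (certificate `M3K5T27` laddered `2` time(s), grafted `1` time(s)). [folklore] -/
theorem row_3_14 : ¬ PosRootLawAt 3 14 83 := by
  have h := ray 2 1
  norm_num at h
  exact h

/-- `ζ_sym(3,15) ≥ 87` (certificate `M3K5T27` laddered `2` time(s), grafted `2` time(s)). [folklore] -/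
theorem row_3_15 : ¬ PosRootLawAt 3 15 86 := by
  have h := ray 2 2
  norm_num at h
  exact h

/-- `ζ_sym(3,17) ≥ 108` (certificate `M3K5T27` laddered `3` time(s), grafted `0` time(s)). [folklore] -/
theorem row_3_17 : ¬ PosRootLawAt 3 17 107 := by
  have h := ray 3 0
  norm_num at h
  exact h

end Summit.ValiantsHypothesis.ValiantsHypothesis.Theorems.LacunarySymmetroidMatrixDescartes.Census.Chain.RayM3K5T27
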